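import Literature.RepresentationTheory.Kovacevic2021.SU21UnitarityCriterion
import Literature.RepresentationTheory.Kovacevic2021.SU21ConeWeights
import HarnessLib

/-!
# Unitarity of the cone module `D₁ = W(3,0)` (the discrete series with `H^{1,1}`)

Continuation of `Literature.RepresentationTheory.Kovacevic2021.SU21UnitarityCriterion` (unitarizability from
weights solving three recursions) and `SU21ConeWeights` (the explicit solution
`coneWeight p q k = F(p)F(q)G(p+q)β_{3+p+q}(k-1)` on the cone).  The datum `midDS` of `SU21ModulesFromKTypes`
(`K`-types `V_{3+p+q,3p-3q}`, arrows `A = -(p+2)(p+3)`, `B = -(q+2)(q+3)`, `C = q/((n-1)n)`, `D = p/((n-1)n)`)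
is Kovačević's `W(3,0)`, Borel–Wallach's discrete series `D₁` of `SU(2,1)`; [Kovacevic2021, §4 Thm 4, Thm 5]
lists `W(r,s)` with `s+r+1 > 0 > s-r-1` as unitary and [BorelWallach2000, VI 4.8] records the `D_i` as discrete
series representations.  Here: `midDS_isUnitarizable` — the weights `c(n,m,k) = coneWeight(p,q,k)`
(`p = (3n-9+m)/6`, `q = (3n-9-m)/6`) define an invariant positive definite Hermitian form.
Theorems only (plus the bookkeeping definition `midWeight`); no named facts.

## References

* D. Kovačević, *Unitary `(𝔤,K)` modules of `SU(2,1)`*, Acta Math. Spalatensia 1 (2021) 105–125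
  (arXiv:1810.01752): §4 Thm 4, Thm 5 (`W(r,s)` unitary for `s+r+1 > 0`, `s-r-1 < 0`). [Kovacevic2021]
* A. Borel, N. Wallach (2000), VI 4.8 p. 131, Thm 4.12 p. 133. [BorelWallach2000]
-/

noncomputable section

namespace Literature.RepresentationTheory.Kovacevic2021

-- Mathlib idiom (Mathlib/Algebra/Lie/OfAssociative.lean): commutator brackets on associative algebras; needed for
-- the `𝔤𝔩(3,ℂ)`-module structure on `𝒟.V`, as in every file of this directory.
attribute [local instance 100] LieRing.ofAssociativeRing

namespace SU21Datum

/-- the weight of the label `(n,m,k)` of the cone, read through `p = (3n-9+m)/6`, `q = (3n-9-m)/6`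
[cite: Kovacevic2021, §4 proof of Thm 4] -/
def midWeight (n m k : ℤ) : ℝ := coneWeight ((3 * n - 9 + m) / 6).toNat ((3 * n - 9 - m) / 6).toNat k

/-- on the `K`-type `(3+p+q, 3p-3q)` the weight is `coneWeight p q k` [cite: Kovacevic2021, §4 proof of Thm 4] -/
theorem midWeight_eq (p q : ℕ) {n m : ℤ} (hn : n = 3 + p + q) (hm : m = 3 * p - 3 * q) (k : ℤ) :
    midWeight n m k = coneWeight p q k := by
  unfold midWeight
  rw [show ((3 * n - 9 + m) / 6).toNat = p by omega, show ((3 * n - 9 - m) / 6).toNat = q by omega]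

/-- **`D₁ = W(3,0)` (the discrete series with `H^{1,1}`) is unitarizable**: the cone weights define an
invariant positive definite Hermitian form on `midDS`.
[cite: Kovacevic2021, §4 Thm 4, Thm 5] [cite: BorelWallach2000, VI 4.8, Thm 4.12] -/
theorem midDS_isUnitarizable : IsUnitarizable midDS := by
  refine isUnitarizable_of_weights _ midWeight ?_ ?_ ?_ ?_
  · rintro n m k ⟨p, q, hn, hm⟩ hk hkn
    change n = 3 + p + q at hn
    change m = 3 * p - 3 * q at hm
    rw [midWeight_eq p q hn hm]
    exact coneWeight_pos p q hk (by push_cast; omega)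
  · rintro n m k ⟨p, q, hn, hm⟩ hk _
    change n = 3 + p + q at hn
    change m = 3 * p - 3 * q at hm
    rw [midWeight_eq p q hn hm, midWeight_eq p q hn hm, coneWeight_succ_k p q hk, hn]
    push_cast
    ring
  · -- the `A`–`D` edge `(p,q) → (p+1,q)`
    rintro n m k ⟨p, q, hn, hm⟩ ⟨p', q', hn', hm'⟩ hk hkn
    change n = 3 + p + q at hn
    change m = 3 * p - 3 * q at hm
    change n + 1 = 3 + p' + q' at hn'
    change m + 3 = 3 * p' - 3 * q' at hm'
    obtain rfl : p' = p + 1 := by omega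
    obtain rfl : q = q' := by omega
    subst hn hm
    have hA : midDS.A (3 + p + q) (3 * p - 3 * q) = -(((p : ℂ) + 2) * (p + 3)) := midA_eq p q rfl rfl
    have hD : midDS.D (3 + p + q + 1) (3 * p - 3 * q + 3)
        = ((p : ℂ) + 1) / ((3 + p + q) * (3 + p + q + 1)) := by
      have h := midD_eq (p + 1) q (n := 3 + p + q + 1) (m := 3 * p - 3 * q + 3) (by push_cast; ring)
        (by push_cast; ring)
      rw [show midDS.D (3 + p + q + 1) (3 * p - 3 * q + 3) = midD (3 + p + q + 1) (3 * p - 3 * q + 3)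
        from rfl, h]
      push_cast
      ring
    have hkn' : k ≤ ((3 + p + q : ℕ) : ℤ) := by push_cast; omega
    have e := congrArg (fun x : ℝ => (x : ℂ)) (coneWeight_succ_p p q hk hkn')
    rw [hA, hD, midWeight_eq (p + 1) q (n := 3 + p + q + 1) (m := 3 * p - 3 * q + 3) (by push_cast; ring)
      (by push_cast; ring), midWeight_eq p q rfl rfl]
    simp only [map_neg, map_mul, map_add, map_natCast, map_ofNat]
    push_cast at e ⊢
    linear_combination (-1 : ℂ) * e
  · -- the `B`–`C` edge `(p,q'+1) → (p,q')`
    rintro n m k ⟨p, q, hn, hm⟩ ⟨p', q', hn', hm'⟩ hk hkn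
    change n = 3 + p + q at hn
    change m = 3 * p - 3 * q at hm
    change n - 1 = 3 + p' + q' at hn'
    change m + 3 = 3 * p' - 3 * q' at hm'
    obtain rfl : p = p' := by omega
    obtain rfl : q = q' + 1 := by omega
    subst hn hm
    have hC : midDS.C (3 + p + (q' + 1 : ℕ)) (3 * p - 3 * (q' + 1 : ℕ))
        = ((q' : ℂ) + 1) / ((3 + p + q') * (3 + p + q' + 1)) := by
      rw [show midDS.C (3 + p + (q' + 1 : ℕ)) (3 * p - 3 * (q' + 1 : ℕ))
        = midC (3 + p + (q' + 1 : ℕ)) (3 * p - 3 * (q' + 1 : ℕ)) from rfl, midC_eq p (q' + 1) rfl rfl]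
      push_cast
      ring
    have hB : midDS.B (3 + p + (q' + 1 : ℕ) - 1) (3 * p - 3 * (q' + 1 : ℕ) + 3) = -(((q' : ℂ) + 2) * (q' + 3)) :=
      midB_eq p q' (by push_cast; ring) (by push_cast; ring)
    have hkn' : k ≤ ((3 + p + q' : ℕ) : ℤ) := by push_cast at hkn ⊢; omega
    have e := congrArg (fun x : ℝ => (x : ℂ)) (coneWeight_succ_q p q' hk hkn')
    rw [hC, hB, midWeight_eq p q' (n := 3 + p + (q' + 1 : ℕ) - 1) (m := 3 * p - 3 * (q' + 1 : ℕ) + 3)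
      (by push_cast; ring) (by push_cast; ring), midWeight_eq p (q' + 1) rfl rfl]
    simp only [map_div₀, map_mul, map_add, map_natCast, map_ofNat, map_one]
    push_cast at e ⊢
    linear_combination (-1 : ℂ) * e

end SU21Datum

end Literature.RepresentationTheory.Kovacevic2021
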